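import Literature.Computability.Complexity.Williams2014ValueTerms
import HarnessLib

/-!
# Williams' generator `A` (Lemma 3.1), part 4: VALUE on codes and the stage function of `A`

R. Williams, *Nonuniform ACC circuit lower bounds*, J. ACM 61 (2014), proof of Lemma 3.1
(pp. 10–12). The polynomial-time part of the machine `A` — "parse the guessed circuits, print
the satisfiability instance VALUE, print `C'ₓ`" — as MATHEMATICAL FUNCTIONS on codes (their
membership in `FP` is part 5, `Williams2014StageAFP.lean`; the machine is assembled in
`Williams2014MachineA.lean`):

* `SatCode.dnfCodeList w bcs terms`: the code (`circuitCodeList`) of the DNF circuit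
  `MachineA.dnfCircuit blocks terms` of `Williams2014ValueCircuit.lean`, computed from the codes
  `bcs = [(wireC C.output, C.gates.map (gateC m)) | C ∈ blocks]` alone
  (`circuitCodeList_dnfCircuit`), mirroring the construction stage by stage (`parBlocksC` of
  `Williams2014SatInstanceCode.lean` for the block layer);
* `MachineA.stageA c m M pT dE qE x z`: parse the guess `z` into families of circuit codes
  (total decoders `decNil`, `decStr`), validate them (`SatCode.deserialize'`, `SatCode.validC`
  with depth `dE`, size `qE(n)`, the right number of families and circuits), canonicalise, print
  the code of VALUE on them with the terms `allTerms` of `Williams2014ValueTerms.lean`, the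
  validity flag and the codes of the `3 (w + 2)` output circuits;
* its two properties used by the machine: **soundness glue** (`stageA_sound`: the printed
  instance is the code of `dnfCircuit blocks (allTerms x)` for the REALISED circuits
  `blocks` (`SatCode.realize`), which are over `accBasis m`, of depth `≤ dE`, size `≤ qE(n)` and
  fan-in `≤ |z|`, and when the flag is up the printout is `encodeAccCircuitList` of the output
  circuits among them) and **completeness glue** (`stageA_complete`: on the genuine guess —
  the codes of families of circuits meeting the bounds — the flag is up and the instance is the
  code of `dnfCircuit` of THOSE circuits).

Everything is proved; no named fact is introduced.

## References

* R. Williams, *Nonuniform ACC circuit lower bounds*, J. ACM 61 (2014) 2:1–2:32, Lemma 3.1 and its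
  proof (pp. 10–12) [Williams2014].
* S. Arora, B. Barak, *Computational Complexity: A Modern Approach*, CUP 2009, §0.1 (codes of
  lists), §6.1 (circuits as straight-line programs) [AroraBarakCC2009].
-/

noncomputable section

namespace Literature.Computability.Complexity

open Turing _root_.Computability Polynomial CodeFP Brick

/-! ### VALUE on codes -/

namespace SatCode

open MachineA GateList

variable (n : ℕ)

/-- The block layer on codes (`sGC`: `parBlocksC` of the (gates, output) codes). [folklore] -/
def layerC (bcs : List (WireC × List GateC)) : List GateC × List WireC := sGC bcs

/-- `L1` on codes. [folklore] -/
def L1C (bcs : List (WireC × List GateC)) : ℕ := (layerC bcs).1.length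

/-- `base` on codes: the layer, then `∨₀` (code `2`) and `∧₀` (code `1`). [folklore] -/
def baseC (bcs : List (WireC × List GateC)) : List GateC := (layerC bcs).1 ++ [(2, []), (1, [])]

/-- The constant-`0` wire code. [folklore] -/
def fWC (bcs : List (WireC × List GateC)) : WireC := (1, L1C bcs)

/-- The constant-`1` wire code. [folklore] -/
def tWC (bcs : List (WireC × List GateC)) : WireC := (1, L1C bcs + 1)

/-- `outW` on codes. [folklore] -/
def outWC (bcs : List (WireC × List GateC)) (k : ℕ) : WireC :=
  if k < bcs.length then (layerC bcs).2.getD k (0, 0) else fWC bcs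

/-- `inW` on codes. [folklore] -/
def inWC (bcs : List (WireC × List GateC)) (j : ℕ) : WireC := if j < n then (0, j) else fWC bcs

/-- `withNots` on codes. [folklore] -/
def withNotsC (bcs : List (WireC × List GateC)) : List GateC :=
  baseC bcs ++ (((List.range bcs.length).map fun k => ((0 : ℕ), [outWC bcs k])) ++
    ((List.range n).map fun j => ((0 : ℕ), [inWC n bcs j])))

/-- `notOutW` on codes. [folklore] -/
def notOutWC (bcs : List (WireC × List GateC)) (k : ℕ) : WireC :=
  if k < bcs.length then (1, L1C bcs + 2 + k) else tWC bcs

/-- `notInW` on codes. [folklore] -/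
def notInWC (bcs : List (WireC × List GateC)) (j : ℕ) : WireC :=
  if j < n then (1, L1C bcs + 2 + bcs.length + j) else tWC bcs

/-- `litW` on codes. [folklore] -/
def litWC (bcs : List (WireC × List GateC)) (l : Lit) : WireC :=
  if l.2.1 then (if l.1 then notInWC n bcs l.2.2 else inWC n bcs l.2.2)
  else (if l.1 then notOutWC bcs l.2.2 else outWC bcs l.2.2)

/-- `termGate` on codes (`∧` has code `1` at every arity). [folklore] -/
def termGateC (bcs : List (WireC × List GateC)) (t : List Lit) : GateC := (1, t.map (litWC n bcs))

/-- `L2` on codes. [folklore] -/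
def L2C (bcs : List (WireC × List GateC)) : ℕ := L1C bcs + 2 + bcs.length + n

/-- `withTerms` on codes. [folklore] -/
def withTermsC (bcs : List (WireC × List GateC)) (terms : List (List Lit)) : List GateC :=
  withNotsC n bcs ++ terms.map (termGateC n bcs)

/-- `finalGate` on codes (`∨ₖ` has code `orCode k`). [folklore] -/
def finalGateC (bcs : List (WireC × List GateC)) (terms : List (List Lit)) : GateC :=
  (orCode terms.length, (List.range terms.length).map fun r => ((1 : ℕ), L2C n bcs + r))

/-- `dnfGates` on codes. [folklore] -/
def dnfGatesC (bcs : List (WireC × List GateC)) (terms : List (List Lit)) : List GateC :=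
  withTermsC n bcs terms ++ [finalGateC n bcs terms]

/-- The output wire code of VALUE. [folklore] -/
def dnfOutC (bcs : List (WireC × List GateC)) (terms : List (List Lit)) : WireC :=
  (1, L2C n bcs + terms.length)

/-- **The code of VALUE** (`circuitCodeList` of `dnfCircuit`, from the block codes).
[cite: Williams2014, Lemma 3.1 (proof)] -/
def dnfCodeList (bcs : List (WireC × List GateC)) (terms : List (List Lit)) : List ℕ :=
  serialize n (dnfOutC n bcs terms) (dnfGatesC n bcs terms)

/-! #### The code of VALUE is computed from the codes of the blocks -/

/-- The (output, gates) codes of a list of circuits. [folklore] -/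
def blockCodes (m : ℕ) {n : ℕ} (blocks : List (Circuit (Fin n))) : List (WireC × List GateC) :=
  blocks.map fun C => (wireC C.output, C.gates.map (gateC m))

variable {n} (m : ℕ) (blocks : List (Circuit (Fin n))) (terms : List (List Lit))

/-- The block layer prints as `layerC` of the block codes. [folklore] -/
theorem layerL_code : (layerL blocks).1.map (gateC m) = (layerC (blockCodes m blocks)).1 ∧
    (layerL blocks).2.map wireC = (layerC (blockCodes m blocks)).2 := by
  have h := map_gateC_parBlocks m (blocks.map fun C => (C.gates, C.output))
  rw [List.map_map] at h
  have e : sGC (blockCodes m blocks) =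
      parBlocksC (blocks.map ((fun b : List (Gate (Fin n)) × (Fin n ⊕ ℕ) => (b.1.map (gateC m), wireC b.2)) ∘
        fun C => (C.gates, C.output))) := by
    rw [sGC, blockCodes, List.map_map]; rfl
  rw [layerC, e]
  exact h

/-- `L1` agrees. [folklore] -/
theorem L1_code : L1 blocks = L1C (blockCodes m blocks) := by
  rw [L1, L1C, ← (layerL_code m blocks).1, List.length_map]

/-- `|blocks|` agrees. [folklore] -/
@[simp] theorem length_blockCodes : (blockCodes m blocks).length = blocks.length := List.length_map ..

/-- The code of `∨₀`/`∧₀`. [folklore] -/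
theorem gateC_bigGate_zero (b : Bool) :
    gateC m (bigGate b 0 (Fin.elim0 : Fin 0 → Fin n ⊕ ℕ)) = (if b then 1 else 2, []) := by
  have h1 : (bigGate b 0 (Fin.elim0 : Fin 0 → Fin n ⊕ ℕ)).fn = if b then GateFn.and 0 else GateFn.or 0 :=
    bigGate_fn _ _ _
  have h2 : List.ofFn (bigGate b 0 (Fin.elim0 : Fin 0 → Fin n ⊕ ℕ)).args = [] := List.ofFn_zero
  rw [gateC, h1, h2]
  cases b
  · simp [accCode_or, orCode]
  · simp [accCode_and]

/-- `base` prints as `baseC`. [folklore] -/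
theorem base_code : (base blocks).map (gateC m) = baseC (blockCodes m blocks) := by
  rw [base, baseC, List.map_append, (layerL_code m blocks).1]
  simp [gateC_bigGate_zero]

/-- `outW` prints as `outWC`. [folklore] -/
theorem wireC_outW (k : ℕ) : wireC (outW blocks k) = outWC (blockCodes m blocks) k := by
  unfold outW outWC
  rw [length_blockCodes]
  split_ifs with h
  · rw [← (layerL_code m blocks).2, List.getD_eq_getElem _ _ (by rw [List.length_map, length_layerL_snd]; exact h),
      List.getElem_map]
  · rw [fW, fWC, L1_code m blocks]; rfl

/-- `inW` prints as `inWC`. [folklore] -/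
theorem wireC_inW (j : ℕ) : wireC (inW blocks j) = inWC n (blockCodes m blocks) j := by
  unfold inW inWC
  split_ifs with h
  · rfl
  · rw [fW, fWC, L1_code m blocks]; rfl

/-- `withNots` prints as `withNotsC`. [folklore] -/
theorem withNots_code : (withNots blocks).map (gateC m) = withNotsC n (blockCodes m blocks) := by
  rw [withNots, withNotsC, List.map_append, List.map_append, base_code, List.map_map, List.map_map,
    length_blockCodes]
  congr 2
  · exact List.map_congr_left fun k _ => by simp [Function.comp, gateC_notGate, wireC_outW m blocks k]
  · exact List.map_congr_left fun j _ => by simp [Function.comp, gateC_notGate, wireC_inW m blocks j]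

/-- `litW` prints as `litWC`. [folklore] -/
theorem wireC_litW (l : Lit) : wireC (litW blocks l) = litWC n (blockCodes m blocks) l := by
  unfold litW litWC notInW notInWC notOutW notOutWC tW tWC
  rw [length_blockCodes, ← L1_code m blocks]
  split_ifs <;> first | rfl | exact wireC_inW m blocks _ | exact wireC_outW m blocks _

/-- `List.ofFn` through `List.get` is `map`. [folklore] -/
theorem ofFn_get_map {α β : Type*} (l : List α) (f : α → β) : (List.ofFn fun q => f (l.get q)) = l.map f := by
  apply List.ext_getElem <;> simp

/-- `termGate` prints as `termGateC`. [folklore] -/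
theorem gateC_termGate (t : List Lit) : gateC m (termGate blocks t) = termGateC n (blockCodes m blocks) t := by
  refine Prod.ext ?_ ?_
  · show accCode m (GateFn.and t.length) = 1
    exact accCode_and m _
  · show (List.ofFn fun q : Fin t.length => litW blocks (t.get q)).map wireC = t.map (litWC n (blockCodes m blocks))
    rw [ofFn_get_map, List.map_map]
    exact List.map_congr_left fun l _ => wireC_litW m blocks l

/-- `L2` agrees. [folklore] -/
theorem L2_code : L2 blocks = L2C n (blockCodes m blocks) := by
  rw [L2, L2C, L1_code m blocks, length_blockCodes]

/-- `List.ofFn` of a function of the index value is `map` over `range`. [folklore] -/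
theorem ofFn_val_eq_map_range {β : Type*} (k : ℕ) (f : ℕ → β) : (List.ofFn fun r : Fin k => f r) = (List.range k).map f := by
  apply List.ext_getElem <;> simp

/-- `finalGate` prints as `finalGateC`. [folklore] -/
theorem gateC_finalGate : gateC m (finalGate blocks terms) = finalGateC n (blockCodes m blocks) terms := by
  refine Prod.ext ?_ ?_
  · show accCode m (GateFn.or terms.length) = orCode terms.length
    exact accCode_or m _
  · show (List.ofFn fun r : Fin terms.length => (Sum.inr (L2 blocks + r) : Fin n ⊕ ℕ)).map wireC =
      (List.range terms.length).map fun r => ((1 : ℕ), L2C n (blockCodes m blocks) + r)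
    rw [ofFn_val_eq_map_range terms.length (fun r => (Sum.inr (L2 blocks + r) : Fin n ⊕ ℕ)), List.map_map,
      L2_code m blocks]
    rfl

/-- **The code of VALUE is `dnfCodeList` of the block codes.** [cite: Williams2014, Lemma 3.1 (proof)] -/
theorem circuitCodeList_dnfCircuit :
    circuitCodeList m (dnfCircuit blocks terms) = dnfCodeList n (blockCodes m blocks) terms := by
  rw [circuitCodeList_eq_serialize, output_dnfCircuit, gates_dnfCircuit, dnfCodeList]
  congr 1
  · rw [dnfOutC, length_withTerms, L2_code m blocks]; rfl
  · rw [dnfGates, dnfGatesC, List.map_append, List.map_singleton, gateC_finalGate, withTerms, withTermsC,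
      List.map_append, withNots_code, List.map_map]
    congr 2
    exact List.map_congr_left fun t _ => gateC_termGate m blocks t

end SatCode

/-! ### The stage function of `A` -/

namespace MachineA

open SatCode Tableau

attribute [local instance] Turing.FinTM2.kFin Turing.FinTM2.ΛFin Turing.FinTM2.σFin
  Turing.FinTM2.Γk₀Fin

/-- **The total parser of a guess**: families (items of the second pair component), each a list
of circuit codes (again items of the second component), each read as a list of naturals
(`SatCode.decStr`). On `listE (listE (listE natE)) fams` it returns `fams` (`parseGuess_listE`).
[cite: AroraBarakCC2009, §0.1] -/
def parseGuess (z : List Bool) : List (List (List ℕ)) :=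
  (decNil (sndF z)).map fun f => (decNil (sndF f)).map decStr

/-- The parser inverts the code of families. [folklore] -/
theorem parseGuess_listE (fams : List (List (List ℕ))) :
    parseGuess (listE (listE (listE natE)) fams) = fams := by
  rw [parseGuess, show listE (listE (listE natE)) fams = boolPair (unE fams.length) (rawE (listE (listE natE)) fams)
    from rfl, sndF_boolPair, decNil_rawE, List.map_map]
  conv_rhs => rw [← List.map_id fams]
  refine List.map_congr_left fun f _ => ?_
  simp only [Function.comp_apply, id]
  rw [show listE (listE natE) f = boolPair (unE f.length) (rawE (listE natE) f) from rfl, sndF_boolPair,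
    decNil_rawE, List.map_map]
  conv_rhs => rw [← List.map_id f]
  exact List.map_congr_left fun l _ => decStr_listE l

/-- **A circuit code is admissible**: it deserialises, has `w` inputs and is valid for depth `dE`
and size `sz`. [folklore] -/
def codeOK (w dE sz : ℕ) (l : List ℕ) : Bool :=
  (deserialize' l).1 && decide ((deserialize' l).2.1 = w) &&
    validC w dE sz (deserialize' l).2.2.1 (deserialize' l).2.2.2

/-- The (output, canonical gates) code of a circuit code. [folklore] -/
def codeBlock (m : ℕ) (l : List ℕ) : WireC × List GateC :=
  ((deserialize' l).2.2.1, (deserialize' l).2.2.2.map (canonC m))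

/-- **The families are admissible**: `nF` families of `NV` admissible codes each. [folklore] -/
def famsOK (w dE sz NV nF : ℕ) (fams : List (List (List ℕ))) : Bool :=
  decide (fams.length = nF) && fams.all fun f => decide (f.length = NV) && f.all (codeOK w dE sz)

/-- The realised circuit of a circuit code. [folklore] -/
def codeCircuit (m w dE sz : ℕ) (l : List ℕ) : Circuit (Fin w) :=
  realize m w dE sz (deserialize' l).2.2.1 (deserialize' l).2.2.2

section Stage

/-- The validity flag of `A` on `⟨x, z⟩`. [folklore] -/
def okA (c : ℕ) (M : TM2ComputableAux Bool Bool) (pT : Polynomial ℕ) (dE : ℕ) (qE : Polynomial ℕ)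
    (x z : List Bool) : Bool :=
  famsOK (succinctWidth c x.length) dE (qE.eval x.length) (NVn c M pT x.length) (nFam c x.length) (parseGuess z)

/-- The block codes used by `A` (none if the guess is not admissible). [folklore] -/
def bcsA (c m : ℕ) (M : TM2ComputableAux Bool Bool) (pT : Polynomial ℕ) (dE : ℕ) (qE : Polynomial ℕ)
    (x z : List Bool) : List (WireC × List GateC) :=
  if okA c M pT dE qE x z then (parseGuess z).flatten.map (codeBlock m) else []

/-- The terms used by `A` (none if the guess is not admissible). [folklore] -/
def termsA (c : ℕ) (M : TM2ComputableAux Bool Bool) (pT : Polynomial ℕ) (dE : ℕ) (qE : Polynomial ℕ)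
    (x z : List Bool) : List (List Lit) :=
  if okA c M pT dE qE x z then allTerms M c pT x else []

/-- The printed codes of the output circuits (positions `0 … 3(w+2) - 1`). [folklore] -/
def printA (c m : ℕ) (M : TM2ComputableAux Bool Bool) (pT : Polynomial ℕ) (dE : ℕ) (qE : Polynomial ℕ)
    (x z : List Bool) : List (List ℕ) :=
  (List.range (3 * (succinctWidth c x.length + 2))).map fun p =>
    serialize (succinctWidth c x.length)
      ((bcsA c m M pT dE qE x z).getD (outIdx c M pT x.length p) ((0, 0), [])).1
      ((bcsA c m M pT dE qE x z).getD (outIdx c M pT x.length p) ((0, 0), [])).2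

/-- **The stage function of `A`**: the code of VALUE, the validity flag, the printout.
[cite: Williams2014, Lemma 3.1 (proof)] -/
def stageA (c m : ℕ) (M : TM2ComputableAux Bool Bool) (pT : Polynomial ℕ) (dE : ℕ) (qE : Polynomial ℕ)
    (x z : List Bool) : List ℕ × Bool × List (List ℕ) :=
  (dnfCodeList (succinctWidth c x.length) (bcsA c m M pT dE qE x z) (termsA c M pT dE qE x z),
    okA c M pT dE qE x z, printA c m M pT dE qE x z)

/-- The realised blocks of `A`. [folklore] -/
def blocksA (c m : ℕ) (M : TM2ComputableAux Bool Bool) (pT : Polynomial ℕ) (dE : ℕ) (qE : Polynomial ℕ)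
    (x z : List Bool) : List (Circuit (Fin (succinctWidth c x.length))) :=
  if okA c M pT dE qE x z then
    (parseGuess z).flatten.map (codeCircuit m (succinctWidth c x.length) dE (qE.eval x.length))
  else []

variable {c m : ℕ} {M : TM2ComputableAux Bool Bool} {pT : Polynomial ℕ} {dE : ℕ} {qE : Polynomial ℕ}


/-- Admissible families, unfolded. [folklore] -/
theorem famsOK_iff {w dE sz NV nF : ℕ} {fams : List (List (List ℕ))} :
    famsOK w dE sz NV nF fams = true ↔
      fams.length = nF ∧ ∀ f ∈ fams, f.length = NV ∧ ∀ l ∈ f, codeOK w dE sz l = true := by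
  simp [famsOK, Bool.and_eq_true, List.all_eq_true]

/-- An admissible code, unfolded. [folklore] -/
theorem codeOK_iff {w dE sz : ℕ} {l : List ℕ} : codeOK w dE sz l = true ↔
    (deserialize' l).1 = true ∧ (deserialize' l).2.1 = w ∧
      validC w dE sz (deserialize' l).2.2.1 (deserialize' l).2.2.2 = true := by
  simp [codeOK, Bool.and_eq_true, and_assoc]

/-- **The block codes of `A` are the codes of its realised blocks.** [folklore] -/
theorem bcsA_eq_blockCodes (x z : List Bool) :
    bcsA c m M pT dE qE x z = blockCodes m (blocksA c m M pT dE qE x z) := by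
  unfold bcsA blocksA
  split_ifs with hok
  · rw [blockCodes, List.map_map]
    refine List.map_congr_left fun l hl => ?_
    obtain ⟨f, hf, hlf⟩ := List.mem_flatten.1 hl
    have hc := ((famsOK_iff.1 hok).2 f hf).2 l hlf
    obtain ⟨-, -, hv⟩ := codeOK_iff.1 hc
    simp only [Function.comp_apply, codeBlock, codeCircuit]
    rw [wireC_realize_output hv, map_gateC_realize hv]
  · rfl

/-- Items of the parse are short. [folklore] -/
theorem length_le_of_mem_parseGuess {z : List Bool} {f : List (List ℕ)} (hf : f ∈ parseGuess z) {l : List ℕ}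
    (hl : l ∈ f) : l.length ≤ z.length := by
  unfold parseGuess at hf
  obtain ⟨f', hf', rfl⟩ := List.mem_map.1 hf
  obtain ⟨a, ha, rfl⟩ := List.mem_map.1 hl
  have h1 := two_mul_length_le_of_mem_decNil hf'
  have h2 := two_mul_length_le_of_mem_decNil ha
  have h3 := length_decStr_le a
  have h4 := length_fstF_sndF_le z
  have h5 := length_fstF_sndF_le f'
  omega

/-- **The realised blocks are in the class**: over `accBasis m`, depth `≤ dE`, size `≤ qE(n)`,
fan-in `≤ |z|`. [folklore] -/
theorem blocksA_class (x z : List Bool) :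
    ∀ C ∈ blocksA c m M pT dE qE x z, C.IsOver (accBasis m) ∧ C.acDepth ≤ dE ∧ C.size ≤ qE.eval x.length ∧
      C.maxFanIn ≤ z.length := by
  intro C hC
  unfold blocksA at hC
  split_ifs at hC with hok
  · obtain ⟨l, hl, rfl⟩ := List.mem_map.1 hC
    obtain ⟨f, hf, hlf⟩ := List.mem_flatten.1 hl
    have hc := ((famsOK_iff.1 hok).2 f hf).2 l hlf
    obtain ⟨hflag, hw, hv⟩ := codeOK_iff.1 hc
    refine ⟨realize_isOver hv, acDepth_realize_le hv, ?_, ?_⟩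
    · rw [codeCircuit, size_realize hv]; exact (validC_parts hv).2.2.1
    · refine Circuit.maxFanIn_le_of_forall _ fun g hg => ?_
      rw [codeCircuit, realize_gates hv] at hg
      obtain ⟨gc, hgc, rfl⟩ := List.mem_map.1 hg
      have hdes := deserialize_of_flag hflag
      have harity := arity_le_of_deserialize (n := (deserialize' l).2.1) (out := (deserialize' l).2.2.1)
        (gs := (deserialize' l).2.2.2) hdes gc hgc
      have hlen := length_le_of_mem_parseGuess hf hlf
      change gc.2.length ≤ z.length
      omega
  · simp at hC

/-- **Soundness glue**: the printed instance is the code of VALUE on the realised blocks, and when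
the flag is up there are `nFam · NV` of them and the printout lists the codes of the output blocks.
[cite: Williams2014, Lemma 3.1 (proof)] -/
theorem stageA_sound (x z : List Bool) :
    (stageA c m M pT dE qE x z).1 =
      circuitCodeList m (dnfCircuit (blocksA c m M pT dE qE x z) (termsA c M pT dE qE x z)) ∧
    (okA c M pT dE qE x z = true →
      termsA c M pT dE qE x z = allTerms M c pT x ∧
      (blocksA c m M pT dE qE x z).length = nFam c x.length * NVn c M pT x.length ∧
      ∀ p < 3 * (succinctWidth c x.length + 2), ∃ h : outIdx c M pT x.length p < (blocksA c m M pT dE qE x z).length,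
        (printA c m M pT dE qE x z)[p]? = some (circuitCodeList m ((blocksA c m M pT dE qE x z)[outIdx c M pT x.length p]))) := by
  refine ⟨?_, fun hok => ⟨by rw [termsA, if_pos hok], ?_, fun p hp => ?_⟩⟩
  · rw [stageA, circuitCodeList_dnfCircuit, bcsA_eq_blockCodes]
  · unfold blocksA
    rw [if_pos hok, List.length_map, List.length_flatten]
    obtain ⟨hlen, hall⟩ := famsOK_iff.1 hok
    rw [show (parseGuess z).map List.length = (parseGuess z).map (fun _ => NVn c M pT x.length) from
      List.map_congr_left fun f hf => (hall f hf).1, List.map_const', List.sum_replicate, hlen, smul_eq_mul]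
  · have hlenB : (blocksA c m M pT dE qE x z).length = nFam c x.length * NVn c M pT x.length := by
      unfold blocksA
      rw [if_pos hok, List.length_map, List.length_flatten]
      obtain ⟨hlen, hall⟩ := famsOK_iff.1 hok
      rw [show (parseGuess z).map List.length = (parseGuess z).map (fun _ => NVn c M pT x.length) from
        List.map_congr_left fun f hf => (hall f hf).1, List.map_const', List.sum_replicate, hlen, smul_eq_mul]
    have hidx : outIdx c M pT x.length p < (blocksA c m M pT dE qE x z).length := by
      rw [hlenB, outIdx]
      have hr : rOut c M pT x.length < NVn c M pT x.length := by
        unfold rOut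
        exact rIdx_lt c pT (Tableau.blk_lt M _ _ _ le_rfl (by
          have := Tableau.S1_unfold M (nX c x.length) (succinctWidth c x.length) (TT c pT x.length)
          have := Tableau.one_le_dM M; omega))
      calc 2 * p * NVn c M pT x.length + rOut c M pT x.length
          < 2 * p * NVn c M pT x.length + NVn c M pT x.length := by omega
        _ = (2 * p + 1) * NVn c M pT x.length := by ring
        _ ≤ nFam c x.length * NVn c M pT x.length := Nat.mul_le_mul_right _ (by unfold nFam; omega)
    refine ⟨hidx, ?_⟩
    rw [printA, List.getElem?_map, List.getElem?_range hp, Option.map_some, bcsA_eq_blockCodes, blockCodes,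
      List.getD_eq_getElem _ _ (by rw [List.length_map]; exact hidx), List.getElem_map,
      circuitCodeList_eq_serialize]

/-- **Completeness glue**: on the code of `nFam` families of `NV` circuits on `w` inputs over
`accBasis m` of depth `≤ dE` and size `≤ qE(n)`, the flag is up, the terms are all terms, and the
printed instance is the code of VALUE on THESE circuits. [cite: Williams2014, Lemma 3.1 (proof)] -/
theorem stageA_complete (x : List Bool) (fams : List (List (Circuit (Fin (succinctWidth c x.length)))))
    (hlen : fams.length = nFam c x.length) (hfam : ∀ f ∈ fams, f.length = NVn c M pT x.length ∧
      ∀ C ∈ f, C.IsOver (accBasis m) ∧ C.acDepth ≤ dE ∧ C.size ≤ qE.eval x.length) :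
    okA c M pT dE qE x (listE (listE (listE natE)) (fams.map fun f => f.map (circuitCodeList m))) = true ∧
    (stageA c m M pT dE qE x (listE (listE (listE natE)) (fams.map fun f => f.map (circuitCodeList m)))).1 =
      circuitCodeList m (dnfCircuit fams.flatten (allTerms M c pT x)) := by
  have hparse := parseGuess_listE (fams.map fun f => f.map (circuitCodeList m))
  have hcode : ∀ f ∈ fams, ∀ C ∈ f,
      deserialize' (circuitCodeList m C) = (true, succinctWidth c x.length, wireC C.output, C.gates.map (gateC m)) ∧
      validC (succinctWidth c x.length) dE (qE.eval x.length) (wireC C.output) (C.gates.map (gateC m)) = true ∧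
      (C.gates.map (gateC m)).map (canonC m) = C.gates.map (gateC m) := by
    intro f hf C hC
    obtain ⟨hO, hd, hs⟩ := (hfam f hf).2 C hC
    refine ⟨deserialize'_of_some ?_, validC_of_circuit m C hO hd hs, map_canonC_map_gateC m C hO⟩
    rw [circuitCodeList_eq_serialize]
    exact deserialize_serialize _ _ _
  have hok : okA c M pT dE qE x (listE (listE (listE natE)) (fams.map fun f => f.map (circuitCodeList m))) = true := by
    rw [okA, hparse, famsOK_iff]
    refine ⟨by rw [List.length_map, hlen], fun f' hf' => ?_⟩
    obtain ⟨f, hf, rfl⟩ := List.mem_map.1 hf'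
    refine ⟨by rw [List.length_map]; exact (hfam f hf).1, fun l hl => ?_⟩
    obtain ⟨C, hC, rfl⟩ := List.mem_map.1 hl
    obtain ⟨hdes, hv, -⟩ := hcode f hf C hC
    rw [codeOK_iff, hdes]
    exact ⟨rfl, rfl, hv⟩
  refine ⟨hok, ?_⟩
  rw [stageA, termsA, if_pos hok, bcsA, if_pos hok, hparse, circuitCodeList_dnfCircuit]
  show dnfCodeList _ _ _ = _
  congr 1
  rw [← List.map_flatten, List.map_map, blockCodes]
  refine List.map_congr_left fun C hC => ?_
  obtain ⟨f, hf, hCf⟩ := List.mem_flatten.1 hC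
  obtain ⟨hdes, -, hcan⟩ := hcode f hf C hCf
  simp only [Function.comp_apply, codeBlock, hdes, hcan]

end Stage

end MachineA

end Literature.Computability.Complexity
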